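import Mathlib
import Literature.Probability.Percolation.Percolation
import HarnessLib

/-!
# IkhlefPonsaingFirstPassage

Topic `Literature/Probability/Percolation`. Named literature fact(s) relocated by the gate from `Summits/CriticalPhenomena/CardyFormulaZ2/Theorems/CardyComplexConeEdgePrecompactIpExact.lean`
(accept-time relocation of `[cite]`d propositions written inline in a Summits proposal; human ruling 2026-08-15).
Sources: IkhlefPonsaing2012.

* `Literature.Probability.Percolation.IkhlefPonsaingFirstPassage`
-/

namespace Literature.Probability.Percolation

open MeasureTheory
open scoped BigOperators
open Literature.Probability.LatticeModels Literature.Probability.Percolation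

/-- **Ikhlef–Ponsaing's first-site passage probability of the percolation strip** (Ikhlef–Ponsaing,
J. Stat. Phys. 149 (2012) 10–36 = arXiv:1202.5476, Proposition 4.7, with the explicit products printed
there): "The expression for `P_b^{(L)}` in the homogeneous limit is
`P_b^{(L)} = A_V(L) A_V(L+2) / N_8(L+1)²`, where
`A_V(2m+1) = ∏_{i=0}^{m-1} (3i+2)(6i+3)!(2i+1)! / ((4i+2)!(4i+3)!)` and
`N_8(2m) = ∏_{i=0}^{m-1} (3i+1)(6i)!(2i)! / ((4i)!(4i+1)!)` (the numbers of vertically symmetric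
alternating sign matrices and of cyclically symmetric self-complementary plane partitions)"; here
`P_b^{(L)}` (their Definition 4.1, `L` odd) is the probability that the infinite hull of the width-`L`
Temperley–Lieb strip at `n = 1` with reflecting walls passes through the first site of a
between-double-row cut. PERCOLATION DICTIONARY (their §2.1–2.2 and §4, Baxter's equivalence; proved for
each configuration, not only in law): that loop model at the homogeneous point is bond percolation at
`p = 1/2` on the diagonal strip `{x : ℤ² | 0 ≤ x₀ + x₁ ≤ L}` (tiles = edges between consecutive levels of
`x₀ + x₁`) with the wall `x₀ + x₁ = 0` wired and the wall `x₀ + x₁ = L` free, and — after the lattice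
reflection `u ↦ L − u` composed with planar self-duality — the passage event is "the site `b` of level
`L − 1 = 2m` is joined to some wall site `w`, `w₀ + w₁ = 0`, by an open path all of whose vertices lie in
the strip" (no use of the wall's wiring: stop at the first wall site). Statement: for every `m` and
every `b` with `b₀ + b₁ = 2m`, `P_{1/2}` of that event equals `A_V(2m+1) A_V(2m+3) / N_8(2m+2)²`
(`= 1, 3/4, 78/121, 247/425, 210/391, …`), the three products written out literally. Numerically
certified EXACTLY for `m ≤ 4` by a rational transfer-matrix computation (evidence on
stmt-CriticalPhenomena-11387). The general-`m` proof is the paper's `q`KZ computation (Props. 4.1, 4.3,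
4.5, 4.7; transfer-matrix ground state = polynomial `q`KZ solution after Di Francesco–Zinn-Justin 2005 and
de Gier–Pyatov 2007), refereed and published; not yet formalised.
[cite: IkhlefPonsaing2012, Prop. 4.7] [topic Probability/Percolation] -/
def IkhlefPonsaingFirstPassage : Prop :=
  ∀ (m : ℕ) (b : Site 2), b 0 + b 1 = 2 * m →
    (bondPercolation (zdGraph 2) half).real
        {ω | ∃ w : Site 2, w 0 + w 1 = 0 ∧
          ω ∈ openConnIn {x : Site 2 | 0 ≤ x 0 + x 1 ∧ x 0 + x 1 ≤ ((2 * m + 1 : ℕ) : ℤ)} b w} =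
      (∏ i ∈ Finset.range m,
          ((3 * i + 2 : ℕ) * (6 * i + 3).factorial * (2 * i + 1).factorial : ℝ) /
            ((4 * i + 2).factorial * (4 * i + 3).factorial : ℝ)) *
        (∏ i ∈ Finset.range (m + 1),
          ((3 * i + 2 : ℕ) * (6 * i + 3).factorial * (2 * i + 1).factorial : ℝ) /
            ((4 * i + 2).factorial * (4 * i + 3).factorial : ℝ)) /
      (∏ i ∈ Finset.range (m + 1),
          ((3 * i + 1 : ℕ) * (6 * i).factorial * (2 * i).factorial : ℝ) /
            ((4 * i).factorial * (4 * i + 1).factorial : ℝ)) ^ 2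

end Literature.Probability.Percolation
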